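/-
Copyright (c) 2026 the pub-hodgecm-mathlib formalisation cell (harness21).  Prover seat hodgecm-mathlib-K2E3-p12 (g9), programme R90-TF,
section S4 = Rogawski Ch. 13.1–2 (base `R90-C131`), deal S4-W3 (W3-2) C-INJ (S4 dealer K2E2-plan (g6), 2026-09-04T21:35Z); h413 = `stmt-HodgeConjecture-24833`.
-/
import Summits.HodgeConjecture.HodgeConjecture.Theorems.R90S4TwistedCharLiftLemmas   -- ★ (η) p862006∕K2E3-p21: lift-predicate API; brings ★ `R90S4LocalBaseChangeDefs` (`IsTwistedCharLiftWith`, `chiPacket`, `twistedTraceSet`), ★ `R90S4TwistedTraceTransport` (`twistedTraceSet_pairwise_smul`)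
import Summits.HodgeConjecture.HodgeConjecture.Theorems.R90S4TwistedTransferDefs     -- ★ C-TT ED. 2 p862174: `IsEpsTransferPair`, `IsLocalEpsCoTransferExists` (S4-R7 generic orbit-space σ-algebra binders)
import HarnessLib

/-!
# R90-TF · S4 (Ch. 13.1–2) · C-INJ — the STEP-1 lift `ψ_G` is INJECTIVE ON PACKET MEMBERS modulo linear independence of characters

Cell `hodgecm-mathlib`, crux H413 (`stmt-HodgeConjecture-24833`), route of record `HCCMUnconditional`; programme R90-TF, section S4 = Rogawski
Ch. 13.1–2 (base `R90-C131`), seat K2E3-p12 (g9), deal S4-W3 (W3-2) C-INJ of the S4 dealer K2E2-plan (g6).  Lane `--supports stmt-HodgeConjecture-24833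
--as helper`; ONE named-input definition + theorems (no instance, no notation, no `sorry`); Theorems-only imports (never `Cruxes/…`); generic over a ★
`LocalPacketKit` `𝔩`, so Lines C ED. 2 pays socket S4#C3 (`stub_R90_S4_thm1321_injective`) by ONE application at the kit of record.

THE MATHEMATICS ([Rogawski1990, §13.2 Thm. 13.2.1 p. 200]: «`ψ_G` is injective … by Proposition 4.10.1 (a) and the linear independence of
characters»).  Let `π̃ ∈ E_ε(G̃_v)` be a STEP-1 lift of two packets `Π`, `Π′` of `G_v` for one transfer relation `φ → f` (★ `IsTwistedCharLiftWith`):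
twisted characters `T`, `T′ ∈ twistedTraceSet π̃` with `T φ = χ_Π(f)`, `T′ φ = χ_{Π′}(f)` on smooth pairs `φ → f`.  By Schur rigidity (★
`twistedTraceSet_pairwise_smul`: «a choice of `π̃(ε)`» is unique up to `ℂˣ`) `T′ = c • T` with `c ≠ 0`; if every smooth `f` on `G_v` HAS a smooth
pre-image `φ → f` (Prop. 4.10.1 (a), converse clause = ★ `IsLocalEpsCoTransferExists`, a NAMED INPUT of S4), then `χ_{Π′}(f) = c · χ_Π(f)` for every
test function `f` (§2).  Writing `χ_Π = Σ_{π ∈ Π} ⟨1, π⟩ χ_π` (★ `chiPacket`), the distribution `Σ_{π ∈ Π ∪ Π′} (𝟙_{Π′}⟨1, π⟩′ − c 𝟙_Π ⟨1, π⟩) χ_π`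
vanishes on `C_c^∞(G_v)`; by LINEAR INDEPENDENCE OF THE CHARACTERS of pairwise inequivalent admissible irreducibles (§1 `CharLinIndepG`, a NAMED
INPUT: [Rogawski1990, §12.5 p. 182]; [BernsteinZelevinsky1976, §2]; [BushnellHenniart2006, §2]) every coefficient is `0`, so — when all `⟨1, π⟩`,
`⟨1, π⟩′` are non-zero (print: `±1`) — `Π` and `Π′` have the SAME MEMBERS (§3).  (Lines C then concludes `Π = Π′` from FILE A's ★ (KM1)
`rogawskiLocalKit_mem_injective`.)
* §1 `CharLinIndepG ν` (generic `G`) + `_iff`.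
* §2 `chiPacket_eq_smul_of_lifts_of_coTransfer` (generic transfer relation `T𝔯` with a co-transfer on test functions) and the S4 instance
  **`chiPacket_eq_smul_of_lifts`** (`T𝔯 = IsEpsTransferPair L Φ v mGt mG`, hypothesis ★ `IsLocalEpsCoTransferExists L Φ v mGt mG`).
* §3 `indicator_one_sub_smul_eq_zero_of_lifts_of_coTransfer` (the vanishing coefficients), `mem_eq_of_lifts_of_coTransfer`, and the S4 instance
  **`mem_eq_of_lifts`**.
No hermitian hypothesis on `Φ` is needed: two realisations of `ε_v` agree pointwise (★ `IsEpsRealisation`), so the two `twistedTraceSet`s coincide.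
The compact open subgroup `K ≤ G̃_v` is a binder, as in ★ (η).

HONEST LABEL: support lemmas + ONE named-input definition (`CharLinIndepG`, stated not assumed) — no socket moves by this file; HC_CM is proved only
modulo the 7 printed citations (2 remaining named inputs: hLiu418 = `stmt-HodgeConjecture-24832`, h413 = `stmt-HodgeConjecture-24833`) until rung 0
closes.  REL ≠ ★ ≠ BUILT.

## References
* [Rogawski1990] J. D. Rogawski, *Automorphic Representations of Unitary Groups in Three Variables*, Ann. of Math. Stud. 123 (1990): §13.2 Thm. 13.2.1
  and its proof p. 200; §4.10 Prop. 4.10.1 (a) p. 58; §12.5 p. 182 (characters as distributions).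
* [BernsteinZelevinsky1976] I. N. Bernstein, A. V. Zelevinsky, *Representations of the group GL(n, F) where F is a non-archimedean local field*,
  Russian Math. Surveys 31:3 (1976), §2 (linear independence of characters of irreducible admissible representations).
* [BushnellHenniart2006] C. J. Bushnell, G. Henniart, *The Local Langlands Conjecture for GL(2)*, Grundlehren 335 (2006), §2.
-/

set_option autoImplicit false
set_option linter.dupNamespace false

noncomputable section

open MeasureTheory
open scoped NumberField Matrix
open Literature.NumberTheory.Rogawski1990 (IsLocSmooth)

namespace Summit.HodgeConjecture.HodgeConjecture.R90.S4

open Literature.NumberTheory.Automorphic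
open IsDedekindDomain NumberField
open Summit.HodgeConjecture.HodgeConjecture.Cruxes.H413.F0P3LocalPacketKit

/-! ## §1 The named input: linear independence of the characters of admissible irreducibles (generic `G`) -/

section LinIndep

variable {G : Type*} [TopologicalSpace G] [Group G] [IsTopologicalGroup G] [MeasurableSpace G]

/-- **(LI-G) Linear independence of characters — NAMED INPUT.**  For the (Haar) measure `ν` of `G`: for every finite set `s` of ADMISSIBLE
irreducible classes and every coefficient function `a`, if the distribution `f ↦ Σ_{π ∈ s} a π · χ_π(f)` (★ `IrrClass.smoothTrace`) vanishes on all
test functions `f ∈ C_c^∞(G)` (★ `IsLocSmooth`), then `a π = 0` for every `π ∈ s` — «the linear independence of characters» invoked in the proof of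
Thm. 13.2.1 (distinct classes in `s` are pairwise inequivalent by construction of ★ `IrrClass`).  Stated, never proved here.
[cite: Rogawski1990, §13.2 p. 200; §12.5 p. 182] [cite: BernsteinZelevinsky1976, §2] [cite: BushnellHenniart2006, §2] -/
def CharLinIndepG (ν : Measure G) : Prop :=
  ∀ (s : Finset (IrrClass G)) (a : IrrClass G → ℂ), (∀ π ∈ s, π.IsAdmissible) →
    (∀ f : G → ℂ, IsLocSmooth f → ∑ π ∈ s, a π * π.smoothTrace ν f = 0) → ∀ π ∈ s, a π = 0

/-- Unfolding of `CharLinIndepG`. [cite: Rogawski1990, §12.5 p. 182] -/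
theorem charLinIndepG_iff (ν : Measure G) :
    CharLinIndepG ν ↔
      ∀ (s : Finset (IrrClass G)) (a : IrrClass G → ℂ), (∀ π ∈ s, π.IsAdmissible) →
        (∀ f : G → ℂ, IsLocSmooth f → ∑ π ∈ s, a π * π.smoothTrace ν f = 0) → ∀ π ∈ s, a π = 0 :=
  Iff.rfl

end LinIndep

/-! ## §2 Two packets with a common lift have PROPORTIONAL packet characters `χ_{Π′} = c · χ_Π`, `c ≠ 0` -/

section Lifts

variable {L : Type} [Field L] [NumberField L] [IsCMField L] {Φ : GL (Fin 3) L}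
  {v : HeightOneSpectrum (𝓞 ↥(maximalRealSubfield L))}
  [MeasurableSpace (GtLoc L v)]
  [MeasurableSpace ((UnitaryGroup.cmDatum L 3 (Φ : Matrix (Fin 3) (Fin 3) L)).Local v)]
  {T𝔯 : (GtLoc L v → ℂ) → ((UnitaryGroup.cmDatum L 3 (Φ : Matrix (Fin 3) (Fin 3) L)).Local v → ℂ) → Prop}
  {𝔩 : LocalPacketKit L (Φ : Matrix (Fin 3) (Fin 3) L) v}
  {νG : Measure ((UnitaryGroup.cmDatum L 3 (Φ : Matrix (Fin 3) (Fin 3) L)).Local v)} {νGt : Measure (GtLoc L v)}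
  {P P' : 𝔩.Pkt} {πt : IrrClass (GtLoc L v)}

/-- **`χ_{Π′} = c · χ_Π` on test functions, `c ≠ 0`, when one `π̃` lifts both `Π` and `Π′`** — for ANY transfer relation `T𝔯` admitting a
co-transfer on test functions (`hco`: every smooth `f` on `G_v` has a smooth `φ` with `T𝔯 φ f`) and `G̃_v` with a compact open subgroup `K`: the two
twisted characters of the lift identities lie in ONE `twistedTraceSet` (the two realisations of `ε_v` agree pointwise), hence differ by `c ∈ ℂˣ`
(★ `twistedTraceSet_pairwise_smul`, admissibility from `E_ε`), and the identities transport `c` to the packet characters through `hco`.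
[cite: Rogawski1990, §13.2 Thm. 13.2.1 p. 200; §4.10 Prop. 4.10.1 (a) p. 58] -/
theorem chiPacket_eq_smul_of_lifts_of_coTransfer
    {K : Subgroup (GtLoc L v)} (hKo : IsOpen (K : Set (GtLoc L v))) (hKc : IsCompact (K : Set (GtLoc L v)))
    (hco : ∀ f : (UnitaryGroup.cmDatum L 3 (Φ : Matrix (Fin 3) (Fin 3) L)).Local v → ℂ, IsLocSmooth f →
      ∃ φ : GtLoc L v → ℂ, IsLocSmooth φ ∧ T𝔯 φ f)
    (h : IsTwistedCharLiftWith Φ T𝔯 𝔩 νG νGt P πt) (h' : IsTwistedCharLiftWith Φ T𝔯 𝔩 νG νGt P' πt) :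
    ∃ c : ℂ, c ≠ 0 ∧ ∀ f : (UnitaryGroup.cmDatum L 3 (Φ : Matrix (Fin 3) (Fin 3) L)).Local v → ℂ, IsLocSmooth f →
      chiPacket 𝔩 νG P' f = c * chiPacket 𝔩 νG P f := by
  obtain ⟨hcls, e, he, T, hT, hid⟩ := h
  obtain ⟨-, e', he', T', hT', hid'⟩ := h'
  have hee : (e' : GtLoc L v → GtLoc L v) = e := funext fun g => (he' g).trans (he g).symm
  rw [hee] at hT'
  obtain ⟨c, hc, rfl⟩ := twistedTraceSet_pairwise_smul hcls.isAdmissible hKo hKc νGt hT hT'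
  refine ⟨c, hc, fun f hf => ?_⟩
  obtain ⟨φ, hφ, hr⟩ := hco f hf
  rw [← hid' φ f hφ hf hr, Pi.smul_apply, smul_eq_mul, hid φ f hφ hf hr]

end Lifts

section LiftsS4

variable {L : Type} [Field L] [NumberField L] [IsCMField L] {Φ : GL (Fin 3) L}
  {v : HeightOneSpectrum (𝓞 ↥(maximalRealSubfield L))}
  [MeasurableSpace (GtLoc L v)]
  [MeasurableSpace ((UnitaryGroup.cmDatum L 3 (Φ : Matrix (Fin 3) (Fin 3) L)).Local v)]
  [∀ δ : GtLoc L v, MeasurableSpace (GtLoc L v ⧸ Literature.NumberTheory.Rogawski1990.Ch4Sec10.epsCentralizer (epsLoc L Φ v) δ)]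
  [∀ γ : (UnitaryGroup.cmDatum L 3 (Φ : Matrix (Fin 3) (Fin 3) L)).Local v,
    MeasurableSpace ((UnitaryGroup.cmDatum L 3 (Φ : Matrix (Fin 3) (Fin 3) L)).Local v ⧸
      Subgroup.centralizer ({γ} : Set ((UnitaryGroup.cmDatum L 3 (Φ : Matrix (Fin 3) (Fin 3) L)).Local v)))]
  {mGt : Literature.NumberTheory.Rogawski1990.Ch4Sec10.EpsOrbitalMeasureFamily (epsLoc L Φ v) ⊥}
  {mG : OrbitalMeasureFamily ((UnitaryGroup.cmDatum L 3 (Φ : Matrix (Fin 3) (Fin 3) L)).Local v)}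
  {𝔩 : LocalPacketKit L (Φ : Matrix (Fin 3) (Fin 3) L) v}
  {νG : Measure ((UnitaryGroup.cmDatum L 3 (Φ : Matrix (Fin 3) (Fin 3) L)).Local v)} {νGt : Measure (GtLoc L v)}
  {P P' : 𝔩.Pkt} {πt : IrrClass (GtLoc L v)}

/-- **S4 instance: `χ_{Π′} = c · χ_Π` on test functions, `c ≠ 0`, when one `π̃` is a STEP-1 lift of both `Π` and `Π′` for the twisted transfer
«`φ → f`» (4.10.2) of record** (★ `IsEpsTransferPair L Φ v mGt mG`), GIVEN Prop. 4.10.1 (a)'s converse clause ★ `IsLocalEpsCoTransferExists` (named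
input) and a compact open `K ≤ G̃_v`. [cite: Rogawski1990, §13.2 Thm. 13.2.1 p. 200; §4.10 Prop. 4.10.1 (a) p. 58] -/
theorem chiPacket_eq_smul_of_lifts
    {K : Subgroup (GtLoc L v)} (hKo : IsOpen (K : Set (GtLoc L v))) (hKc : IsCompact (K : Set (GtLoc L v)))
    (hco : IsLocalEpsCoTransferExists L Φ v mGt mG)
    (h : IsTwistedCharLiftWith Φ (IsEpsTransferPair L Φ v mGt mG) 𝔩 νG νGt P πt)
    (h' : IsTwistedCharLiftWith Φ (IsEpsTransferPair L Φ v mGt mG) 𝔩 νG νGt P' πt) :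
    ∃ c : ℂ, c ≠ 0 ∧ ∀ f : (UnitaryGroup.cmDatum L 3 (Φ : Matrix (Fin 3) (Fin 3) L)).Local v → ℂ, IsLocSmooth f →
      chiPacket 𝔩 νG P' f = c * chiPacket 𝔩 νG P f :=
  chiPacket_eq_smul_of_lifts_of_coTransfer hKo hKc hco h h'

end LiftsS4

/-! ## §3 … hence, by linear independence of characters, the SAME MEMBERS -/

section Members

variable {L : Type} [Field L] [NumberField L] [IsCMField L] {Φ : GL (Fin 3) L}
  {v : HeightOneSpectrum (𝓞 ↥(maximalRealSubfield L))}
  [MeasurableSpace (GtLoc L v)]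
  [MeasurableSpace ((UnitaryGroup.cmDatum L 3 (Φ : Matrix (Fin 3) (Fin 3) L)).Local v)]
  {T𝔯 : (GtLoc L v → ℂ) → ((UnitaryGroup.cmDatum L 3 (Φ : Matrix (Fin 3) (Fin 3) L)).Local v → ℂ) → Prop}
  {𝔩 : LocalPacketKit L (Φ : Matrix (Fin 3) (Fin 3) L) v}
  {νG : Measure ((UnitaryGroup.cmDatum L 3 (Φ : Matrix (Fin 3) (Fin 3) L)).Local v)} {νGt : Measure (GtLoc L v)}
  {P P' : 𝔩.Pkt} {πt : IrrClass (GtLoc L v)}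

open scoped Classical in
/-- **The coefficients vanish**: with (LI-G), a co-transfer on test functions, admissible members, and one common lift `π̃` of `Π` and `Π′`, there is
`c ≠ 0` with `𝟙_{Π′}(π)·⟨1, π⟩′ = c · 𝟙_Π(π)·⟨1, π⟩` for every `π ∈ Π ∪ Π′` (the distribution `χ_{Π′} − c·χ_Π = 0` expanded in the characters `χ_π`).
[cite: Rogawski1990, §13.2 Thm. 13.2.1 p. 200; §12.5 p. 182] -/
theorem indicator_one_eq_smul_of_lifts_of_coTransfer
    {K : Subgroup (GtLoc L v)} (hKo : IsOpen (K : Set (GtLoc L v))) (hKc : IsCompact (K : Set (GtLoc L v)))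
    (hLI : CharLinIndepG νG)
    (hco : ∀ f : (UnitaryGroup.cmDatum L 3 (Φ : Matrix (Fin 3) (Fin 3) L)).Local v → ℂ, IsLocSmooth f →
      ∃ φ : GtLoc L v → ℂ, IsLocSmooth φ ∧ T𝔯 φ f)
    (hP : ∀ π ∈ 𝔩.mem P, π.IsAdmissible) (hP' : ∀ π ∈ 𝔩.mem P', π.IsAdmissible)
    (h : IsTwistedCharLiftWith Φ T𝔯 𝔩 νG νGt P πt) (h' : IsTwistedCharLiftWith Φ T𝔯 𝔩 νG νGt P' πt) :
    ∃ c : ℂ, c ≠ 0 ∧ ∀ π ∈ 𝔩.mem P ∪ 𝔩.mem P',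
      (if π ∈ 𝔩.mem P' then ((𝔩.one P' π : ℤ) : ℂ) else 0) = c * (if π ∈ 𝔩.mem P then ((𝔩.one P π : ℤ) : ℂ) else 0) := by
  classical
  obtain ⟨c, hc, hcP⟩ := chiPacket_eq_smul_of_lifts_of_coTransfer hKo hKc hco h h'
  refine ⟨c, hc, ?_⟩
  -- admissibility on `s = mem P ∪ mem P'`
  have hadm : ∀ π ∈ 𝔩.mem P ∪ 𝔩.mem P', π.IsAdmissible := fun π hπ => by
    rcases Finset.mem_union.1 hπ with h1 | h1
    · exact hP π h1
    · exact hP' π h1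
  -- the two indicator sums over `s` are the packet characters
  have hsumP : ∀ f : (UnitaryGroup.cmDatum L 3 (Φ : Matrix (Fin 3) (Fin 3) L)).Local v → ℂ,
      ∑ π ∈ 𝔩.mem P ∪ 𝔩.mem P', (if π ∈ 𝔩.mem P then ((𝔩.one P π : ℤ) : ℂ) else 0) * π.smoothTrace νG f =
        chiPacket 𝔩 νG P f := fun f => by
    rw [chiPacket_def]
    symm
    refine (Finset.sum_congr rfl fun π hπ => ?_).trans
      (Finset.sum_subset Finset.subset_union_left fun π _ hπ => ?_)
    · rw [if_pos hπ]
    · rw [if_neg hπ, zero_mul]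
  have hsumP' : ∀ f : (UnitaryGroup.cmDatum L 3 (Φ : Matrix (Fin 3) (Fin 3) L)).Local v → ℂ,
      ∑ π ∈ 𝔩.mem P ∪ 𝔩.mem P', (if π ∈ 𝔩.mem P' then ((𝔩.one P' π : ℤ) : ℂ) else 0) * π.smoothTrace νG f =
        chiPacket 𝔩 νG P' f := fun f => by
    rw [chiPacket_def]
    symm
    refine (Finset.sum_congr rfl fun π hπ => ?_).trans
      (Finset.sum_subset Finset.subset_union_right fun π _ hπ => ?_)
    · rw [if_pos hπ]
    · rw [if_neg hπ, zero_mul]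
  -- the combination `χ_{Π′} − c·χ_Π` vanishes on test functions
  have hzero := hLI (𝔩.mem P ∪ 𝔩.mem P')
    (fun π => (if π ∈ 𝔩.mem P' then ((𝔩.one P' π : ℤ) : ℂ) else 0) - c * (if π ∈ 𝔩.mem P then ((𝔩.one P π : ℤ) : ℂ) else 0))
    hadm (fun f hf => by
      have hsplit : ∀ π : IrrClass ((UnitaryGroup.cmDatum L 3 (Φ : Matrix (Fin 3) (Fin 3) L)).Local v),
          ((if π ∈ 𝔩.mem P' then ((𝔩.one P' π : ℤ) : ℂ) else 0) - c * (if π ∈ 𝔩.mem P then ((𝔩.one P π : ℤ) : ℂ) else 0)) *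
              π.smoothTrace νG f =
            (if π ∈ 𝔩.mem P' then ((𝔩.one P' π : ℤ) : ℂ) else 0) * π.smoothTrace νG f -
              c * ((if π ∈ 𝔩.mem P then ((𝔩.one P π : ℤ) : ℂ) else 0) * π.smoothTrace νG f) := fun π => by ring
      simp_rw [hsplit]
      rw [Finset.sum_sub_distrib, ← Finset.mul_sum, hsumP f, hsumP' f, hcP f hf, sub_self])
  intro π hπ
  exact sub_eq_zero.1 (hzero π hπ)

/-- **Two packets with a common STEP-1 lift have the same members** — for ANY transfer relation `T𝔯` with a co-transfer on test functions, GIVEN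
(LI-G) `CharLinIndepG νG`, admissible members with non-zero `⟨1, π⟩` on both packets (print: `⟨1, π⟩ = ±1`), and a compact open `K ≤ G̃_v`.
(`Π = Π′` then follows from the kit's member-injectivity, FILE A.) [cite: Rogawski1990, §13.2 Thm. 13.2.1 p. 200; §12.5 p. 182] -/
theorem mem_eq_of_lifts_of_coTransfer
    {K : Subgroup (GtLoc L v)} (hKo : IsOpen (K : Set (GtLoc L v))) (hKc : IsCompact (K : Set (GtLoc L v)))
    (hLI : CharLinIndepG νG)
    (hco : ∀ f : (UnitaryGroup.cmDatum L 3 (Φ : Matrix (Fin 3) (Fin 3) L)).Local v → ℂ, IsLocSmooth f →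
      ∃ φ : GtLoc L v → ℂ, IsLocSmooth φ ∧ T𝔯 φ f)
    (hP : ∀ π ∈ 𝔩.mem P, π.IsAdmissible ∧ 𝔩.one P π ≠ 0) (hP' : ∀ π ∈ 𝔩.mem P', π.IsAdmissible ∧ 𝔩.one P' π ≠ 0)
    (h : IsTwistedCharLiftWith Φ T𝔯 𝔩 νG νGt P πt) (h' : IsTwistedCharLiftWith Φ T𝔯 𝔩 νG νGt P' πt) :
    𝔩.mem P = 𝔩.mem P' := by
  classical
  obtain ⟨c, hc, hcoef⟩ := indicator_one_eq_smul_of_lifts_of_coTransfer hKo hKc hLI hco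
    (fun π hπ => (hP π hπ).1) (fun π hπ => (hP' π hπ).1) h h'
  ext π
  constructor
  · intro hπ
    by_contra hπ'
    have hx := hcoef π (Finset.mem_union_left _ hπ)
    rw [if_neg hπ', if_pos hπ] at hx
    exact (mul_ne_zero hc (Int.cast_ne_zero.2 (hP π hπ).2)) hx.symm
  · intro hπ'
    by_contra hπ
    have hx := hcoef π (Finset.mem_union_right _ hπ')
    rw [if_pos hπ', if_neg hπ, mul_zero] at hx
    exact (Int.cast_ne_zero.2 (hP' π hπ').2) hx

end Members

section MembersS4

variable {L : Type} [Field L] [NumberField L] [IsCMField L] {Φ : GL (Fin 3) L}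
  {v : HeightOneSpectrum (𝓞 ↥(maximalRealSubfield L))}
  [MeasurableSpace (GtLoc L v)]
  [MeasurableSpace ((UnitaryGroup.cmDatum L 3 (Φ : Matrix (Fin 3) (Fin 3) L)).Local v)]
  [∀ δ : GtLoc L v, MeasurableSpace (GtLoc L v ⧸ Literature.NumberTheory.Rogawski1990.Ch4Sec10.epsCentralizer (epsLoc L Φ v) δ)]
  [∀ γ : (UnitaryGroup.cmDatum L 3 (Φ : Matrix (Fin 3) (Fin 3) L)).Local v,
    MeasurableSpace ((UnitaryGroup.cmDatum L 3 (Φ : Matrix (Fin 3) (Fin 3) L)).Local v ⧸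
      Subgroup.centralizer ({γ} : Set ((UnitaryGroup.cmDatum L 3 (Φ : Matrix (Fin 3) (Fin 3) L)).Local v)))]
  {mGt : Literature.NumberTheory.Rogawski1990.Ch4Sec10.EpsOrbitalMeasureFamily (epsLoc L Φ v) ⊥}
  {mG : OrbitalMeasureFamily ((UnitaryGroup.cmDatum L 3 (Φ : Matrix (Fin 3) (Fin 3) L)).Local v)}
  {𝔩 : LocalPacketKit L (Φ : Matrix (Fin 3) (Fin 3) L) v}
  {νG : Measure ((UnitaryGroup.cmDatum L 3 (Φ : Matrix (Fin 3) (Fin 3) L)).Local v)} {νGt : Measure (GtLoc L v)}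
  {P P' : 𝔩.Pkt} {πt : IrrClass (GtLoc L v)}

/-- **S4 instance — INJECTIVITY OF `ψ_G` ON MEMBERS (Thm. 13.2.1, «by Proposition 4.10.1 (a) and the linear independence of characters»)**: if one
`π̃ ∈ E_ε(G̃_v)` is a STEP-1 lift of both `Π` and `Π′` for the twisted transfer of record ★ `IsEpsTransferPair L Φ v mGt mG`, then `Π` and `Π′` have
the same members — GIVEN (LI-G) `CharLinIndepG νG`, Prop. 4.10.1 (a)'s converse clause ★ `IsLocalEpsCoTransferExists L Φ v mGt mG`, admissible
members with `⟨1, π⟩ ≠ 0`, and a compact open `K ≤ G̃_v`. [cite: Rogawski1990, §13.2 Thm. 13.2.1 p. 200; §4.10 Prop. 4.10.1 (a) p. 58; §12.5 p. 182] -/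
theorem mem_eq_of_lifts
    {K : Subgroup (GtLoc L v)} (hKo : IsOpen (K : Set (GtLoc L v))) (hKc : IsCompact (K : Set (GtLoc L v)))
    (hLI : CharLinIndepG νG) (hco : IsLocalEpsCoTransferExists L Φ v mGt mG)
    (hP : ∀ π ∈ 𝔩.mem P, π.IsAdmissible ∧ 𝔩.one P π ≠ 0) (hP' : ∀ π ∈ 𝔩.mem P', π.IsAdmissible ∧ 𝔩.one P' π ≠ 0)
    (h : IsTwistedCharLiftWith Φ (IsEpsTransferPair L Φ v mGt mG) 𝔩 νG νGt P πt)
    (h' : IsTwistedCharLiftWith Φ (IsEpsTransferPair L Φ v mGt mG) 𝔩 νG νGt P' πt) :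
    𝔩.mem P = 𝔩.mem P' :=
  mem_eq_of_lifts_of_coTransfer hKo hKc hLI hco hP hP' h h'

end MembersS4

end Summit.HodgeConjecture.HodgeConjecture.R90.S4

end
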